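import Literature.Probability.Percolation.SlabMSFInside
import HarnessLib

/-!
# Newman–Tassion–Wu 2017, §4 (proof of Theorem 2.4) — the geometry of the gluing lemma for
# invasion, II: the landing column `z′`, the connectors `Γ_z`, `Γ_w` and the plus cylinder `B̄₁^#(z′)`

Topic: `Literature/Probability/Percolation`.  Second geometry file of the port of NTW's Lemma 4.1
(*Critical percolation and the minimal spanning tree in slabs*, CPAM 70 (2017) = arXiv:1512.09107,
§4.1, pp. 20–21), after `SlabMSFInside.lean` (`R`, `∂R`).  Vocabulary: `planar`, `ht`, `vtx`,
`vline` (`SlabGluingRouting.lean`), the needle `NTW17.CircGlue.vNdl u v g y = u :: vline y (ht v) (ht g)`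
of the circuit gluing layer (`SlabCircuitGlueSurgery.lean`), `edgesOf` (`SlabGluingFact2Core.lean`).

* `NTW17.nearestOver k L y h` — the vertex of the list `L` over the planar point `y` whose height is
  nearest to `h` (first such in `L`; `none` if `L` has no vertex over `y`), the device behind "move in
  `z̄′` until reaching the first vertex in `Γ_min`"; `eq_of_mem_of_between`: no vertex of `L` over `y`
  lies between height `h` and that vertex.
* `NTW17.landVertex` / `NTW17.landCol k Γ z` — the column `z′` of `Γ` adjacent to the column of `z`
  ("if there exists more than one `z′` … choose the minimal one": here the first in the list `Γ`).
* `NTW17.connector k L y u` — the path `Γ_u`: "one edge from `u` to `ū′` and then move in `z̄′`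
  until reaching the first vertex" of `L`, as the needle `vNdl u v g y` with `v` the vertex over `y`
  at the height of `u` and `g = nearestOver L y (ht u)`; `NTW17.gammaZ` = `Γ_z` (target `Γ`),
  `NTW17.gammaW` = `Γ_w` (target `Γ_z ∪ Γ`).  PROVED: no duplicates, lattice chain, head `u`, last
  vertex `g` in the target, inner vertices over `y` and NOT in the target
  (`eq_last_of_mem_connector_of_mem`), consecutive pairs inside the plus cylinder.
* `NTW17.plusCols y` / `NTW17.plusCyl k y` / `NTW17.plusEdges k y` — the five-point set `B₁^#(z′) =
  z′ + {0, ±e₁, ±e₂}`, the cylinder `B̄₁^#(z′)` it generates and the slab edges with both endpoints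
  in it (finite); every slab edge at a vertex of the centre column is such an edge.

What is NOT here (later files): the invasion data `z`, `w`; the surgered configuration and
"`Γ_min(ω′) = Γ_min(ω)`"; Lemma 4.2; probabilities; the explicit count `9k + 4` of `plusEdges`
(only finiteness is proved; a uniform bound is taken where Lemma 4.2 is applied).

## Sources

* C. M. Newman, V. Tassion, W. Wu, *Critical percolation and the minimal spanning tree in slabs*,
  Comm. Pure Appl. Math. 70 (2017) 2084–2120 = arXiv:1512.09107: §4.1, proof of Lemma 4.1 (the
  vertex `z′`, `B₁^#(z)`, `Γ_z`, `Γ_w`, `S(ω′) = B̄₁^#(z′) ∖ Γ_min(ω′)`), pp. 20–21 [NewmanTassionWu2017].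
-/

noncomputable section

namespace Literature.Probability.Percolation

open MeasureTheory LatticeModels SimpleGraph

namespace NTW17

variable {k : ℕ}

/-- Planar adjacency is irreflexive. [folklore] -/
private theorem planarAdj_irrefl' (z : ℤ × ℤ) : ¬ planarAdj z z := by
  obtain ⟨a, b⟩ := z
  simp only [planarAdj, Prod.mk_add_mk, Prod.mk.injEq]
  omega

/-- In `x :: r = l₁ ++ a :: b :: l₂` the entry `b` lies in `r`. [folklore] -/
private theorem mem_tail_of_eq_append_cons_cons {α : Type*} {x a b : α} {r l₁ l₂ : List α}
    (h : x :: r = l₁ ++ a :: b :: l₂) : b ∈ r := by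
  cases l₁ with
  | nil =>
    simp only [List.nil_append, List.cons.injEq] at h
    rw [h.2]; simp
  | cons c l₁ =>
    simp only [List.cons_append, List.cons.injEq] at h
    rw [h.2]; simp

/-! ## The vertex of a list over a column nearest to a given height -/

variable (k)

/-- The distance between the height of `g` and `h` (as `Nat.dist`, subtraction-free for `omega`).
[folklore] -/
def htDist (h : ℕ) (g : slab 3 k) : ℕ := (ht g - h) + (h - ht g)

/-- **The vertex of `L` over the planar point `y` nearest in height to `h`** (the first such vertex
of `L` among the minimisers; `none` iff `L` has no vertex over `y`) — the end point of "move in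
`z̄′` until reaching the first vertex in `Γ_min`". [cite: NewmanTassionWu2017, §4.1 (proof of Lemma 4.1, construction of Γ_z)] -/
def nearestOver (L : List (slab 3 k)) (y : ℤ × ℤ) (h : ℕ) : Option (slab 3 k) :=
  (L.filter fun g => decide (planar k g = y)).argmin (htDist k h)

variable {k}

/-- `nearestOver` is `none` iff no vertex of `L` lies over `y`. [cite: NewmanTassionWu2017, §4.1 (construction of Γ_z)] -/
theorem nearestOver_eq_none_iff {L : List (slab 3 k)} {y : ℤ × ℤ} {h : ℕ} :
    nearestOver k L y h = none ↔ ∀ g ∈ L, planar k g ≠ y := by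
  rw [nearestOver, List.argmin_eq_none, List.filter_eq_nil_iff]
  simp

/-- If some vertex of `L` lies over `y`, `nearestOver` returns a vertex. [cite: NewmanTassionWu2017, §4.1 (construction of Γ_z)] -/
theorem exists_nearestOver_eq_some {L : List (slab 3 k)} {y : ℤ × ℤ} {h : ℕ}
    (hL : ∃ g ∈ L, planar k g = y) : ∃ g, nearestOver k L y h = some g := by
  cases hq : nearestOver k L y h with
  | some g => exact ⟨g, rfl⟩
  | none =>
    exfalso
    obtain ⟨g, hg, hgy⟩ := hL
    exact (nearestOver_eq_none_iff.1 hq) g hg hgy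

/-- What `nearestOver` returns: a vertex of `L` over `y` minimising the height distance to `h` among
the vertices of `L` over `y`. [cite: NewmanTassionWu2017, §4.1 (construction of Γ_z)] -/
theorem nearestOver_spec {L : List (slab 3 k)} {y : ℤ × ℤ} {h : ℕ} {g : slab 3 k}
    (hg : nearestOver k L y h = some g) :
    g ∈ L ∧ planar k g = y ∧ ∀ g' ∈ L, planar k g' = y → htDist k h g ≤ htDist k h g' := by
  have hm : g ∈ List.argmin (htDist k h) (L.filter fun g => decide (planar k g = y)) := hg
  have hgL := List.argmin_mem hm
  rw [List.mem_filter, decide_eq_true_eq] at hgL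
  refine ⟨hgL.1, hgL.2, fun g' hg' hg'y => List.le_of_mem_argmin ?_ hm⟩
  rw [List.mem_filter, decide_eq_true_eq]
  exact ⟨hg', hg'y⟩

/-- **No vertex of `L` lies strictly between**: a vertex over `y` whose height is between `h` and the
height of `g = nearestOver L y h` (inclusive) and which belongs to `L` is `g` itself.
[cite: NewmanTassionWu2017, §4.1 ("until reaching the first vertex in Γ_min")] -/
theorem eq_of_mem_of_between {L : List (slab 3 k)} {y : ℤ × ℤ} {h : ℕ} {g x : slab 3 k}
    (hg : nearestOver k L y h = some g) (hxL : x ∈ L) (hxy : planar k x = y)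
    (h1 : min h (ht g) ≤ ht x) (h2 : ht x ≤ max h (ht g)) : x = g := by
  obtain ⟨-, hgy, hmin⟩ := nearestOver_spec hg
  have hle := hmin x hxL hxy
  simp only [htDist] at hle
  rw [slab_ext_iff, hxy, hgy]
  refine ⟨rfl, ?_⟩
  rcases le_total h (ht g) with hh | hh
  · rw [min_eq_left hh, max_eq_right hh] at *; omega
  · rw [min_eq_right hh, max_eq_left hh] at *; omega

/-! ## The landing column `z′` -/

variable (k)

/-- The first vertex of `Γ` whose column is adjacent to the column of `z` (if any).
[cite: NewmanTassionWu2017, §4.1 (proof of Lemma 4.1: "there exists z′ ∈ Γ_min such that dist(z̄, z̄′) = 1 … choose the minimal one")] -/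
def landVertex (Γ : List (slab 3 k)) (z : slab 3 k) : Option (slab 3 k) :=
  open scoped Classical in
  Γ.find? fun g => decide (planarAdj (planar k z) (planar k g))

/-- **The landing column `z′`**: the planar position of `landVertex Γ z` (junk value `planar z` if
there is none). [cite: NewmanTassionWu2017, §4.1 (proof of Lemma 4.1, the vertex z′)] -/
def landCol (Γ : List (slab 3 k)) (z : slab 3 k) : ℤ × ℤ :=
  ((landVertex k Γ z).map (planar k)).getD (planar k z)

variable {k}

/-- If some column of `Γ` is adjacent to the column of `z`, the landing column is such a column:
it carries a vertex of `Γ` and is adjacent to the column of `z`.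
[cite: NewmanTassionWu2017, §4.1 (proof of Lemma 4.1, the vertex z′)] -/
theorem landCol_spec {Γ : List (slab 3 k)} {z : slab 3 k}
    (h : ∃ g ∈ Γ, planarAdj (planar k z) (planar k g)) :
    (∃ g ∈ Γ, planar k g = landCol k Γ z) ∧ planarAdj (planar k z) (landCol k Γ z) := by
  classical
  cases hq : landVertex k Γ z with
  | none =>
    exfalso
    obtain ⟨g, hg, hadj⟩ := h
    have := (List.find?_eq_none.1 hq) g hg
    simp only [decide_eq_true_eq] at this
    exact this hadj
  | some g =>
    have hg : g ∈ Γ := List.mem_of_find?_eq_some hq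
    have hadj : planarAdj (planar k z) (planar k g) := by
      have := List.find?_some hq
      simpa only [decide_eq_true_eq] using this
    have hcol : landCol k Γ z = planar k g := by simp [landCol, hq]
    rw [hcol]
    exact ⟨⟨g, hg, rfl⟩, hadj⟩

/-- The landing column is not the column of `z`. [cite: NewmanTassionWu2017, §4.1 (dist(z̄, z̄′) = 1)] -/
theorem planar_ne_landCol {Γ : List (slab 3 k)} {z : slab 3 k}
    (h : ∃ g ∈ Γ, planarAdj (planar k z) (planar k g)) : planar k z ≠ landCol k Γ z := by
  intro he
  have := (landCol_spec h).2
  rw [← he] at this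
  exact planarAdj_irrefl' _ this

/-! ## The connectors `Γ_z`, `Γ_w` -/

variable (k)

/-- **The connector `Γ_u` from `u` into the column `y`, towards the list `L`**: "one edge from `u`
to `ū′` and then move in `z̄′` until reaching the first vertex" of `L` — the needle `u, v, …, g`
with `v` the vertex over `y` at the height of `u` and `g = nearestOver L y (ht u)` (junk `[u]` if
`L` has no vertex over `y`). [cite: NewmanTassionWu2017, §4.1 (proof of Lemma 4.1, the paths Γ_z and Γ_w)] -/
def connector (L : List (slab 3 k)) (y : ℤ × ℤ) (u : slab 3 k) : List (slab 3 k) :=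
  match nearestOver k L y (ht u) with
  | some g => CircGlue.vNdl u (vtx k y (ht u)) g y
  | none => [u]

/-- **`Γ_z`**: the connector from the landing point `z` into the landing column `z′`, ending at the
vertex of `Γ` over `z′` nearest in height to `z` ("a self avoiding path `Γ_z` in `B̄₁^#(z′)`
connecting `z(ω)` to `Γ_min(ω)` without touching any other vertices in `Γ_min(ω) ∪ ∂B̄₁^#(z′)`").
[cite: NewmanTassionWu2017, §4.1 (proof of Lemma 4.1, Γ_z)] -/
def gammaZ (Γ : List (slab 3 k)) (z : slab 3 k) : List (slab 3 k) := connector k Γ (landCol k Γ z) z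

/-- **`Γ_w`**: the connector from `w` into the landing column `z′`, ending at the vertex of
`Γ_z ∪ Γ` over `z′` nearest in height to `w` ("a self avoiding path `Γ_w` in `B̄₁^#(z′)` connecting
`w(ω)` to `Γ_min(ω) ∪ Γ_z` without touching any other vertices in `Γ_min(ω) ∪ Γ_z ∪ ∂B̄₁^#(z′)`").
[cite: NewmanTassionWu2017, §4.1 (proof of Lemma 4.1, Γ_w)] -/
def gammaW (Γ : List (slab 3 k)) (z w : slab 3 k) : List (slab 3 k) :=
  connector k (gammaZ k Γ z ++ Γ) (landCol k Γ z) w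

variable {k}

section Connector

variable {L : List (slab 3 k)} {y : ℤ × ℤ} {u g : slab 3 k}

/-- The height of the foot `v = vtx y (ht u)` of the connector is the height of `u`. [folklore] -/
private theorem ht_vtx_ht (y : ℤ × ℤ) (u : slab 3 k) : ht (vtx k y (ht u)) = ht u := ht_vtx (ht_le u) y

/-- The connector as a needle `vNdl u v g y`. [cite: NewmanTassionWu2017, §4.1 (Γ_z, Γ_w)] -/
theorem connector_eq_vNdl (hg : nearestOver k L y (ht u) = some g) :
    connector k L y u = CircGlue.vNdl u (vtx k y (ht u)) g y := by
  simp only [connector, hg]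

/-- The connector, unfolded when `L` has a vertex over `y`. [cite: NewmanTassionWu2017, §4.1 (Γ_z, Γ_w)] -/
theorem connector_eq (hg : nearestOver k L y (ht u) = some g) :
    connector k L y u = u :: vline k y (ht u) (ht g) := by
  rw [connector_eq_vNdl hg]
  unfold CircGlue.vNdl
  rw [ht_vtx_ht]

/-- Membership in the connector. [cite: NewmanTassionWu2017, §4.1 (Γ_z, Γ_w)] -/
theorem mem_connector_iff (hg : nearestOver k L y (ht u) = some g) {x : slab 3 k} :
    x ∈ connector k L y u ↔ x = u ∨ (planar k x = y ∧ min (ht u) (ht g) ≤ ht x ∧ ht x ≤ max (ht u) (ht g)) := by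
  rw [connector_eq hg, List.mem_cons, mem_vline_iff (ht_le u) (ht_le g)]

/-- The connector has no duplicates (for `u` off the column `y`). [cite: NewmanTassionWu2017, §4.1 (Γ_z is self avoiding)] -/
theorem connector_nodup (hg : nearestOver k L y (ht u) = some g) (huy : planar k u ≠ y) :
    (connector k L y u).Nodup := by
  rw [connector_eq_vNdl hg]
  exact CircGlue.vNdl_nodup (by rw [planar_vtx]) (nearestOver_spec hg).2.1 huy

/-- The connector is a lattice chain (for `u` in a column adjacent to `y`). [cite: NewmanTassionWu2017, §4.1 (Γ_z is a path)] -/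
theorem connector_chain (hg : nearestOver k L y (ht u) = some g) (hadj : planarAdj (planar k u) y) :
    (connector k L y u).IsChain (fun a b => (slabGraph 3 k).Adj a b) := by
  rw [connector_eq_vNdl hg]
  refine CircGlue.vNdl_chain (by rw [planar_vtx]) (nearestOver_spec hg).2.1 ?_
  have := vtx_adj_vtx_planar (k := k) hadj (ht u)
  rwa [vtx_planar_ht] at this

/-- The connector is non-empty. [cite: NewmanTassionWu2017, §4.1 (Γ_z)] -/
theorem connector_ne_nil (L : List (slab 3 k)) (y : ℤ × ℤ) (u : slab 3 k) : connector k L y u ≠ [] := by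
  rw [connector]
  cases nearestOver k L y (ht u) <;> simp [CircGlue.vNdl]

/-- The connector starts at `u`. [cite: NewmanTassionWu2017, §4.1 (Γ_z connects z(ω) …)] -/
theorem connector_head (L : List (slab 3 k)) (y : ℤ × ℤ) (u : slab 3 k) :
    (connector k L y u).head (connector_ne_nil L y u) = u := by
  have : ∀ (l : List (slab 3 k)) (hl : l ≠ []), l = connector k L y u → l.head hl = u := by
    intro l hl hlc
    rw [connector] at hlc
    cases hq : nearestOver k L y (ht u) with
    | none => rw [hq] at hlc; subst hlc; rfl
    | some g => rw [hq] at hlc; subst hlc; rfl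
  exact this _ _ rfl

/-- The connector ends at `g = nearestOver L y (ht u)`, a vertex of `L` over `y`.
[cite: NewmanTassionWu2017, §4.1 (Γ_z connects … to Γ_min(ω))] -/
theorem connector_getLast (hg : nearestOver k L y (ht u) = some g) :
    (connector k L y u).getLast (connector_ne_nil L y u) = g := by
  have h := (CircGlue.vNdl_head_last (u := u) (v := vtx k y (ht u)) (g := g) (y := y)
    (by rw [planar_vtx]) (nearestOver_spec hg).2.1).2
  have he := connector_eq_vNdl (L := L) hg
  have : ∀ (l : List (slab 3 k)) (hl : l ≠ []), l = CircGlue.vNdl u (vtx k y (ht u)) g y → l.getLast hl = g := by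
    intro l hl hlc; subst hlc; exact h
  exact this _ _ he

/-- **The inner vertices of the connector avoid `L`**: a vertex of the connector other than `u` that
belongs to `L` is its last vertex `g` ("without touching any other vertices in `Γ_min(ω)`").
[cite: NewmanTassionWu2017, §4.1 (Γ_z touches Γ_min only at its end)] -/
theorem eq_last_of_mem_connector_of_mem (hg : nearestOver k L y (ht u) = some g) {x : slab 3 k}
    (hx : x ∈ connector k L y u) (hxu : x ≠ u) (hxL : x ∈ L) : x = g := by
  rcases (mem_connector_iff hg).1 hx with rfl | ⟨hxy, h1, h2⟩
  · exact absurd rfl hxu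
  · exact eq_of_mem_of_between hg hxL hxy h1 h2

/-- The vertices of the connector other than `u` lie over `y`. [cite: NewmanTassionWu2017, §4.1 (Γ_z ⊆ B̄₁^#(z′): "move in z̄′")] -/
theorem planar_eq_of_mem_connector (hg : nearestOver k L y (ht u) = some g) {x : slab 3 k}
    (hx : x ∈ connector k L y u) (hxu : x ≠ u) : planar k x = y := by
  rcases (mem_connector_iff hg).1 hx with rfl | ⟨hxy, -, -⟩
  · exact absurd rfl hxu
  · exact hxy

/-- `u` is on its connector. [cite: NewmanTassionWu2017, §4.1 (Γ_z ∋ z)] -/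
theorem mem_connector_self (L : List (slab 3 k)) (y : ℤ × ℤ) (u : slab 3 k) : u ∈ connector k L y u := by
  rw [connector]
  cases nearestOver k L y (ht u) <;> simp [CircGlue.vNdl]

/-- The end `g` is on the connector. [cite: NewmanTassionWu2017, §4.1 (Γ_z reaches Γ_min)] -/
theorem last_mem_connector (hg : nearestOver k L y (ht u) = some g) : g ∈ connector k L y u := by
  rw [← connector_getLast hg]; exact List.getLast_mem _

end Connector

/-- `Γ_z` is defined through a vertex of `Γ` over the landing column whenever `z ∈ ∂R`-type data is
available: some column of `Γ` is adjacent to that of `z`. [cite: NewmanTassionWu2017, §4.1 (Γ_z)] -/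
theorem exists_nearestOver_gammaZ {Γ : List (slab 3 k)} {z : slab 3 k}
    (h : ∃ g ∈ Γ, planarAdj (planar k z) (planar k g)) :
    ∃ g, nearestOver k Γ (landCol k Γ z) (ht z) = some g :=
  exists_nearestOver_eq_some (landCol_spec h).1

/-- `Γ_w` is defined through a vertex of `Γ_z ++ Γ` over the landing column (same hypothesis).
[cite: NewmanTassionWu2017, §4.1 (Γ_w)] -/
theorem exists_nearestOver_gammaW {Γ : List (slab 3 k)} {z w : slab 3 k}
    (h : ∃ g ∈ Γ, planarAdj (planar k z) (planar k g)) :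
    ∃ g, nearestOver k (gammaZ k Γ z ++ Γ) (landCol k Γ z) (ht w) = some g := by
  obtain ⟨g, hg, hgy⟩ := (landCol_spec h).1
  exact exists_nearestOver_eq_some ⟨g, List.mem_append_right _ hg, hgy⟩

/-! ## The plus cylinder `B̄₁^#(z′)` -/

variable (k)

/-- **`B₁^#(y) = y + {(0,0), (±1,0), (0,±1)}`**, the five-point plus about `y` in `ℤ²`.
[cite: NewmanTassionWu2017, §4.1 (proof of Lemma 4.1, B₁^#(z))] -/
def plusCols (y : ℤ × ℤ) : Set (ℤ × ℤ) := {q | q = y ∨ planarAdj y q}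

/-- **`B̄₁^#(y)`**, "the cylinder in `S_k` generated by the five-point set `B₁^#`".
[cite: NewmanTassionWu2017, §4.1 (proof of Lemma 4.1, B̄₁^#(z′))] -/
def plusCyl (y : ℤ × ℤ) : Set (slab 3 k) := slabLift k (plusCols y)

/-- **The edges of the slab inside `B̄₁^#(y)`** (both endpoints in the cylinder): the set of edges
whose labels the surgery of Lemma 4.1 may change ("`S(ω′) = B̄₁^#(z′) ∖ Γ_min(ω′)`").
[cite: NewmanTassionWu2017, §4.1 (proof of Lemma 4.1, "Close all the edges in B̄₁^#(z′) … except")] -/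
def plusEdges (y : ℤ × ℤ) : Set (Sym2 (slab 3 k)) :=
  {e | e ∈ (slabGraph 3 k).edgeSet ∧ ∀ v ∈ e, planar k v ∈ plusCols y}

variable {k}

/-- The plus lies in the unit box. [cite: NewmanTassionWu2017, §4.1 (B₁^#(z) ⊆ B₁(z))] -/
theorem plusCols_subset_sqBox (y : ℤ × ℤ) : plusCols y ⊆ sqBox y 1 := by
  rintro q (rfl | hq)
  · exact mem_sqBox_self _ 1
  · exact mem_sqBox_one_of_planarAdj hq

/-- The plus `B₁^#(y)` is a finite set (five points). [cite: NewmanTassionWu2017, §4.1 (B₁^#(z), a five-point set)] -/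
theorem plusCols_finite (y : ℤ × ℤ) : (plusCols y).Finite :=
  (sqBox_finite y 1).subset (plusCols_subset_sqBox y)

/-- The plus cylinder `B̄₁^#(y)` is finite. [cite: NewmanTassionWu2017, §4.1 (B̄₁^#(z′), the cylinder generated by the five-point set)] -/
theorem plusCyl_finite (y : ℤ × ℤ) : (plusCyl k y).Finite := slabLift_finite k (plusCols_finite y)

/-- The edges inside the plus cylinder form a finite set. [cite: NewmanTassionWu2017, §4.1 ("with s equal to the number of edges in B̄₁^#")] -/
theorem plusEdges_finite (y : ℤ × ℤ) : (plusEdges k y).Finite := by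
  refine (((plusCyl_finite (k := k) y).prod (plusCyl_finite (k := k) y)).image
    fun p : slab 3 k × slab 3 k => s(p.1, p.2)).subset ?_
  intro e he
  induction e using Sym2.ind with
  | h a b =>
    exact ⟨(a, b), ⟨he.2 a (Sym2.mem_mk_left a b), he.2 b (Sym2.mem_mk_right a b)⟩, rfl⟩

/-- **Every slab edge at a vertex of the centre column lies inside the plus cylinder.**
[cite: NewmanTassionWu2017, §4.1 (the edges of Γ_z, Γ_w lie in B̄₁^#(z′))] -/
theorem mem_plusEdges_of_adj {y : ℤ × ℤ} {a b : slab 3 k} (ha : planar k a = y)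
    (hab : (slabGraph 3 k).Adj a b) : s(a, b) ∈ plusEdges k y := by
  refine ⟨(SimpleGraph.mem_edgeSet _).2 hab, fun v hv => ?_⟩
  rcases Sym2.mem_iff.1 hv with rfl | rfl
  · exact Or.inl ha
  · rcases (slab_adj_iff a v).1 hab with ⟨-, hpa⟩ | ⟨hpe, -⟩
    · exact Or.inr (by rwa [ha] at hpa)
    · exact Or.inl (by rw [← hpe, ha])

/-- Edges inside the plus cylinder are edges of the slab. [cite: NewmanTassionWu2017, §4.1 (B̄₁^#(z′))] -/
theorem mem_edgeSet_of_mem_plusEdges {y : ℤ × ℤ} {e : Sym2 (slab 3 k)} (he : e ∈ plusEdges k y) :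
    e ∈ (slabGraph 3 k).edgeSet := he.1

/-- **The consecutive pairs of a connector into the column `y` are edges inside `B̄₁^#(y)`.**
[cite: NewmanTassionWu2017, §4.1 (Γ_z, Γ_w ⊆ B̄₁^#(z′))] -/
theorem edgesOf_connector_subset {L : List (slab 3 k)} {y : ℤ × ℤ} {u g : slab 3 k}
    (hg : nearestOver k L y (ht u) = some g) (hadj : planarAdj (planar k u) y) :
    edgesOf (connector k L y u) ⊆ plusEdges k y := by
  rintro e ⟨a, b, l₁, l₂, hl, rfl⟩
  have hch := connector_chain hg hadj
  rw [List.isChain_iff_forall_rel_of_append_cons_cons] at hch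
  have hab : (slabGraph 3 k).Adj a b := hch hl
  have hb : b ∈ connector k L y u := by rw [hl]; simp
  have hbu : b ≠ u := by
    intro hbu
    have hnd := connector_nodup hg (fun h => planarAdj_irrefl' _ (h ▸ hadj))
    rw [connector_eq hg] at hnd hl
    have hb' : b ∈ vline k y (ht u) (ht g) := mem_tail_of_eq_append_cons_cons hl
    rw [hbu] at hb'
    exact (List.nodup_cons.1 hnd).1 hb'
  have hby : planar k b = y := planar_eq_of_mem_connector hg hb hbu
  rw [Sym2.eq_swap]
  exact mem_plusEdges_of_adj hby hab.symm

end NTW17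

end Literature.Probability.Percolation
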